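import Literature.NumberTheory.Sieve.MoebiusShiftedPrimesTypical
import Literature.NumberTheory.Sieve.MoebiusShiftedPrimesMeanSquare
import Literature.NumberTheory.Sieve.MatomakiRadziwillLemma12
import Literature.NumberTheory.LFunctions.DirichletPolynomialLargeValues
import Literature.NumberTheory.LFunctions.DirichletPolynomialDiscreteMeanValue
import HarnessLib

/-!
# Möbius on shifted primes — tools for Proposition 5.1 of Lichtman 2020 (Dirichlet polynomials)

Topic `Literature/NumberTheory/Sieve`, part of the decomposition of the named facts
`Literature.NumberTheory.Sieve.lichtman2020_moebius_shifted_primes_avg` and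
`Literature.NumberTheory.Sieve.lichtman2020_moebius_shifted_primes_avg_power` (J. D. Lichtman,
*Averages of the Möbius function on shifted primes*, Q. J. Math. 73 (2022) 729–757,
arXiv:2009.08969v2 [Lichtman2020], Theorem 1.1) along the corrected chain of
`MoebiusShiftedPrimesTypical.lean` (typical set `S_c = lichtmanTypicalWith c`, `c ≥ 100`).  This file
and `MoebiusShiftedPrimesDirichletMeanValue.lean` PROVE Proposition 5.1 along `S_c`
(`Lichtman2020_dirichletMeanValueWith`) from the §4 inputs: Lemma 4.7 (= Matomäki–Radziwiłł, Ann. of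
Math. 183 (2016), Lemma 12: the tree's PROVED `MatomakiRadziwill2016_lemma12_decomp_holds` of
`MatomakiRadziwillLemma12.lean`), Lemma 4.3 (= MR Lemma 9, named fact `MatomakiRadziwill2016_lemma9`),
Lemma 4.5 (named fact `Lichtman2020_primeCharacterSum`), Lemma 4.1 (the tree's
`dirichletPolynomial_meanSquare_le`) and Lemma 4.4 (= MR Lemma 8, the tree's
`MatomakiRadziwill2016_lemma8` re-run with its exponent constant kept explicit).  Page numbers refer to the held copy `paper:arxiv-2009.08969`.

## Content (all PROVED)

* `Lichtman2020.card_largeValues_primePoly_le` — MR Lemma 8 with explicit constants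
  `#𝒯 ≤ 576 V² T^{2 log V/log P} exp(16 (log T/log P) log log T)` (the tree's proof, whose statement
  hides `16` in an unspecified `C` that the count (5.10) cannot use).
* Windowed polynomials `∑_{M ≤ m ≤ N} w_m m^{-1-it}` in standard form (`stdCoeff`, `sum_Icc_eq_stdForm`,
  `∑ |β_n|² ≤ 2/M`), the mean value bound `∫_{-T}^{T} ≤ 10T/M + 72` (Lemma 4.1) and the
  Halász–Montgomery bound at well-spaced points from MR Lemma 9 (Lemma 4.3);
  `blockCofactorPoly = ` such a window; the geometric tail `∑_{v ≥ v₀} e^{-sv} ≤ e^{-sv₀}(1 + 1/s)`.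
* Prime blocks `primeBlock P Q H v` (`blockPrimePoly` over it), as a dyadic prime polynomial (for
  Lemma 8) and as the primes of a closed interval (for Lemma 4.5); continuity in `t`.
* Unit-interval discretisation: `∫_{T₀}^{T} f ≤ ∑_n ∫_n^{n+1} f`, `unitUnion G = ⋃_{n ∈ G} [n, n+1)`
  (measurable, `∫_{unitUnion G} f = ∑_{n ∈ G} ∫_n^{n+1} f`), maximisers on `[n, n+1]`, and the well
  spacing of points attached to unit intervals of the same parity (`parity_image_facts`).
* `Lichtman2020.lamChi χ = λχ`, `lamChiOn S χ = λχ𝟙_S`; the factorisation hypothesis of Lemma 12 for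
  `a = λχ𝟙_S` with `S = {HasPF[P₁,Q₁] ∧ HasPF[P₂,Q₂]}`, `[P₁,Q₁] ∩ [P₂,Q₂] = ∅` (`lamChiOn_factor`), the
  vanishing of its coprime sum, and Lemma 12 applied to `G` along either interval (`ramare_first`,
  `ramare_second`; hypothesis-shapes `Lemma12With C` (`= ` the body of `MatomakiRadziwill2016_lemma12_decomp`),
  `Lemma9With C`).
* Lemma 4.5 on a block of the second interval (`norm_blockPrimePoly_le_of_L45`) and the growth lemma
  `eventually_small_terms` (`k + L^{a₁} + L^{a₂} + b log L ≤ εL` eventually, `aᵢ < 1`; from the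
  lemmas of `MoebiusShiftedPrimesMeanSquare.lean`, imported for them and for the rest of the chain).

## Sources

* J. D. Lichtman, arXiv:2009.08969v2, §4 (Lemmas 4.1–4.8, pp. 11–13), §5 (pp. 14–15) [Lichtman2020].
* K. Matomäki, M. Radziwiłł, Ann. of Math. (2) 183 (2016), Lemmas 8, 9, 12 [MatomakiRadziwillAnnals2016].
-/

noncomputable section

open Finset Real Complex MeasureTheory Filter
open scoped Topology


namespace Literature.NumberTheory.Sieve.Lichtman2020

open Literature.NumberTheory.LFunctions Literature.NumberTheory.LFunctions.DirichletLargeValues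

set_option maxHeartbeats 800000 in
-- a single long explicit-constant bookkeeping proof (copy of the tree's Lemma 8 with the exponent kept explicit)
/-- **Matomäki–Radziwiłł 2016, Lemma 8, with explicit constants** (large values of Dirichlet
polynomials supported on primes): if `P(s) = ∑_{P ≤ p ≤ 2P} a_p p^{-s}` (`|a_p| ≤ 1`, `p` prime)
satisfies `|P(1+it)| ≥ V⁻¹` on a well-spaced set `𝒯 ⊂ [-T, T]` (`2 ≤ P ≤ T`, `T ≥ e^e`, `V ≥ 1`), then
`#𝒯 ≤ 576 V² T^{2 log V/log P} exp(16 (log T/log P) log log T)`.  This is the bound established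
inside the tree's proof of `MatomakiRadziwill2016_lemma8` (from Lemma 7 with `C₇ = 72`,
`MatomakiRadziwill2016_lemma7_holds`) before its last step absorbs `16` into an unspecified
constant in the exponent; the application in §5 of Lichtman 2020 needs the exponent explicit.
[cite: MatomakiRadziwillAnnals2016, Lemma 8] -/
theorem card_largeValues_primePoly_le (P T V : ℝ) (a : ℕ → ℂ) (𝒯 : Finset ℝ) (hP : 2 ≤ P)
    (hPT : P ≤ T) (hT : Real.exp (Real.exp 1) ≤ T) (hV : 1 ≤ V) (ha : ∀ p, ‖a p‖ ≤ 1)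
    (h𝒯T : ∀ t ∈ 𝒯, |t| ≤ T) (hws : ∀ t ∈ 𝒯, ∀ t' ∈ 𝒯, t ≠ t' → 1 ≤ |t - t'|)
    (hlarge : ∀ t ∈ 𝒯, V⁻¹ ≤ ‖∑ p ∈ (Icc ⌈P⌉₊ ⌊2 * P⌋₊).filter Nat.Prime,
        a p * (p : ℂ) ^ (-(1 + (t : ℂ) * I))‖) :
    (#𝒯 : ℝ) ≤ 576 * V ^ 2 * T ^ (2 * Real.log V / Real.log P)
        * Real.exp (16 * (Real.log T / Real.log P) * Real.log (Real.log T)) := by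
  classical
  obtain ⟨C₇, hC₇72, H7⟩ : ∃ C₇ : ℝ, C₇ = 72 ∧ ∀ (N : ℕ) (a : ℕ → ℂ) (T : ℝ) (𝒯 : Finset ℝ),
      1 ≤ N → 1 ≤ T → (∀ t ∈ 𝒯, |t| ≤ T) → (∀ t ∈ 𝒯, ∀ t' ∈ 𝒯, t ≠ t' → 1 ≤ |t - t'|) →
      ∑ t ∈ 𝒯, ‖∑ n ∈ Finset.Icc 1 N, a n * (n : ℂ) ^ (-((t : ℂ) * I))‖ ^ 2 ≤
        C₇ * (T + N) * Real.log (2 * N) * ∑ n ∈ Finset.Icc 1 N, ‖a n‖ ^ 2 :=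
    ⟨72, rfl, fun N a T 𝒯 hN hT h𝒯 hsep ↦ by
      simpa [mul_assoc] using sum_norm_sq_dirichletPoly_le N a T 𝒯 hN hT h𝒯 hsep⟩
  -- the set of primes and elementary facts
  set S := (Icc ⌈P⌉₊ ⌊2 * P⌋₊).filter Nat.Prime with hS
  have hSprime : ∀ p ∈ S, p.Prime := fun p hp => (Finset.mem_filter.mp hp).2
  have hSge : ∀ p ∈ S, ⌈P⌉₊ ≤ p := fun p hp => (Finset.mem_Icc.mp (Finset.mem_filter.mp hp).1).1
  have hSle : ∀ p ∈ S, p ≤ ⌊2 * P⌋₊ := fun p hp => (Finset.mem_Icc.mp (Finset.mem_filter.mp hp).1).2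
  have hP0 : 0 < P := by linarith
  have hee : Real.exp 1 ≤ Real.log T := by
    rw [← Real.log_exp (Real.exp 1)]; exact Real.log_le_log (Real.exp_pos _) hT
  have he1 : 1 ≤ Real.exp 1 := by have := Real.add_one_le_exp (1:ℝ); linarith
  have hlogT1 : 1 ≤ Real.log T := he1.trans hee
  have hT1 : 1 ≤ T := by
    have : Real.exp (Real.exp 1) ≥ 1 := Real.one_le_exp (by positivity)
    linarith
  have hT0 : 0 < T := by linarith
  have hL1 : 1 ≤ Real.log (Real.log T) := by
    rw [← Real.log_exp 1]; exact Real.log_le_log (Real.exp_pos 1) hee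
  set L := Real.log (Real.log T) with hLdef
  have hlog2 : (1 : ℝ) / 2 ≤ Real.log 2 := by
    have := Real.add_one_le_exp (Real.log 2)
    rw [Real.exp_log (by norm_num)] at this
    by_contra hcon
    push Not at hcon
    have h1 : Real.exp (Real.log 2) < Real.exp (1 / 2) := Real.exp_lt_exp.mpr hcon
    rw [Real.exp_log (by norm_num)] at h1
    have h2 : Real.exp (1 / 2 : ℝ) ≤ 2 := by
      have h3 : Real.exp (1 / 2 : ℝ) ^ 2 = Real.exp 1 := by
        rw [← Real.exp_nat_mul]; norm_num
      nlinarith [Real.exp_one_lt_d9, Real.exp_pos (1 / 2 : ℝ)]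
    linarith
  have hlogP : Real.log 2 ≤ Real.log P := Real.log_le_log (by norm_num) hP
  have hlogP0 : 0 < Real.log P := by linarith
  have hlogPT : Real.log P ≤ Real.log T := Real.log_le_log hP0 hPT
  -- `ρ = log T / log P ≥ 1`, `k = ⌈ρ⌉`
  set ρ := Real.log T / Real.log P with hρ
  have hρ1 : 1 ≤ ρ := by rw [hρ, le_div_iff₀ hlogP0]; linarith
  have hρT : ρ ≤ 2 * Real.log T := by
    rw [hρ, div_le_iff₀ hlogP0]; nlinarith
  set k := ⌈ρ⌉₊ with hk
  have hkρ : ρ ≤ k := Nat.le_ceil ρ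
  have hk1 : 1 ≤ k := by
    have : (0 : ℝ) < k := by linarith
    exact_mod_cast this
  have hkρ' : (k : ℝ) ≤ ρ + 1 := (Nat.ceil_lt_add_one (by linarith)).le
  have hk2ρ : (k : ℝ) ≤ 2 * ρ := by linarith
  have hk0 : (0 : ℝ) < k := by exact_mod_cast hk1
  -- `T ≤ P^k`
  have hPk : T ≤ P ^ k := by
    have h1 : Real.log T ≤ k * Real.log P := by
      have := mul_le_mul_of_nonneg_right hkρ hlogP0.le
      rwa [hρ, div_mul_cancel₀ _ hlogP0.ne'] at this
    calc T = Real.exp (Real.log T) := (Real.exp_log hT0).symm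
      _ ≤ Real.exp (k * Real.log P) := Real.exp_le_exp.mpr h1
      _ = P ^ k := by rw [← Real.log_pow, Real.exp_log (by positivity)]
  -- `N = ⌊2P⌋^k`
  set M := ⌊2 * P⌋₊ with hM
  have hM1 : 1 ≤ M := Nat.le_floor (by push_cast; linarith)
  have hMle : (M : ℝ) ≤ 2 * P := Nat.floor_le (by linarith)
  set N := M ^ k with hN
  have hN1 : 1 ≤ N := Nat.one_le_pow _ _ hM1
  have hprod : ∀ u ∈ Fintype.piFinset (fun _ : Fin k => S), ∏ i, u i ∈ Icc 1 N := by
    intro u hu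
    rw [Fintype.mem_piFinset] at hu
    rw [Finset.mem_Icc]
    constructor
    · exact Nat.one_le_iff_ne_zero.mpr (Finset.prod_ne_zero_iff.mpr fun i _ =>
        (hSprime _ (hu i)).ne_zero)
    · calc ∏ i, u i ≤ ∏ _i : Fin k, M := Finset.prod_le_prod' fun i _ => hSle _ (hu i)
        _ = N := by simp [hN]
  -- the coefficients of `P(s)^k`
  set c : ℕ → ℂ := fun n =>
    (∑ u ∈ (Fintype.piFinset fun _ : Fin k => S).filter (fun u => ∏ i, u i = n), ∏ i, a (u i))
      * (n : ℂ)⁻¹ with hc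
  have hpow : ∀ t : ℝ, (∑ p ∈ S, a p * (p : ℂ) ^ (-(1 + (t : ℂ) * I))) ^ k
      = ∑ n ∈ Icc 1 N, c n * (n : ℂ) ^ (-((t : ℂ) * I)) := by
    intro t
    rw [pow_sum_eq_sum_fiber k S a (1 + t * I) N hprod]
    refine Finset.sum_congr rfl fun n hn => ?_
    have hn0 : (n : ℂ) ≠ 0 := by
      have : 1 ≤ n := (Finset.mem_Icc.mp hn).1
      exact_mod_cast (show n ≠ 0 by omega)
    simp only [hc]
    rw [mul_assoc]
    congr 1
    rw [neg_add, Complex.cpow_add _ _ hn0, Complex.cpow_neg_one]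
  -- Lemma 7
  have h7' := H7 N c T 𝒯 hN1 hT1 h𝒯T hws
  -- lower bound by the large values
  have hlow : (#𝒯 : ℝ) * (V ^ (2 * k))⁻¹
      ≤ ∑ t ∈ 𝒯, ‖∑ n ∈ Icc 1 N, c n * (n : ℂ) ^ (-((t : ℂ) * I))‖ ^ 2 := by
    rw [Finset.card_eq_sum_ones, Nat.cast_sum, Finset.sum_mul]
    refine Finset.sum_le_sum fun t ht => ?_
    rw [Nat.cast_one, one_mul, ← hpow t, norm_pow, ← pow_mul, ← inv_pow, mul_comm]
    exact pow_le_pow_left₀ (by positivity) (hlarge t ht) _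
  -- size of the coefficients
  have hSsum : ∑ p ∈ S, ((p : ℝ) ^ 2)⁻¹ ≤ 2 / P := by
    have h1 : ∀ p ∈ S, ((p : ℝ) ^ 2)⁻¹ ≤ (P ^ 2)⁻¹ := fun p hp => by
      have : P ≤ p := (Nat.le_ceil P).trans (by exact_mod_cast hSge p hp)
      gcongr
    have hcard : (#S : ℝ) ≤ P + 1 := by
      have h2 : #S ≤ #(Icc ⌈P⌉₊ ⌊2 * P⌋₊) := Finset.card_filter_le _ _
      rw [Nat.card_Icc] at h2
      have h3 : (#S : ℝ) ≤ ((⌊2 * P⌋₊ + 1 - ⌈P⌉₊ : ℕ) : ℝ) := by exact_mod_cast h2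
      refine h3.trans ?_
      have h4 := Nat.le_ceil P
      rcases le_or_gt ⌈P⌉₊ (⌊2 * P⌋₊ + 1) with h5 | h5
      · rw [Nat.cast_sub h5]; push_cast; linarith
      · rw [Nat.sub_eq_zero_of_le h5.le]; simp; linarith
    calc ∑ p ∈ S, ((p : ℝ) ^ 2)⁻¹ ≤ ∑ p ∈ S, (P ^ 2)⁻¹ := Finset.sum_le_sum h1
      _ = #S * (P ^ 2)⁻¹ := by rw [Finset.sum_const, nsmul_eq_mul]
      _ ≤ (P + 1) * (P ^ 2)⁻¹ := by gcongr
      _ ≤ 2 / P := by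
          rw [div_eq_mul_inv]
          have : (P + 1) * (P ^ 2)⁻¹ = ((P + 1) / P) * P⁻¹ := by field_simp
          rw [this]
          apply mul_le_mul_of_nonneg_right _ (by positivity)
          rw [div_le_iff₀ hP0]; linarith
  have hcoef : ∑ n ∈ Icc 1 N, ‖c n‖ ^ 2 ≤ k.factorial * (2 / P) ^ k := by
    set F : ℕ → Finset (Fin k → ℕ) := fun n =>
      (Fintype.piFinset fun _ : Fin k => S).filter (fun u => ∏ i, u i = n) with hF
    have hm : ∀ n, (#(F n) : ℝ) ≤ k.factorial := fun n => by
      exact_mod_cast card_filter_prod_eq_le_factorial k S hSprime n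
    have hcn : ∀ n ∈ Icc 1 N, ‖c n‖ ≤ #(F n) * (n : ℝ)⁻¹ := by
      intro n hn
      have hn1 : (1 : ℝ) ≤ n := by exact_mod_cast (Finset.mem_Icc.mp hn).1
      simp only [hc, hF]
      rw [norm_mul, norm_inv, Complex.norm_natCast]
      apply mul_le_mul_of_nonneg_right _ (by positivity)
      refine (norm_sum_le _ _).trans ?_
      calc ∑ u ∈ (Fintype.piFinset fun _ : Fin k => S).filter (fun u => ∏ i, u i = n), ‖∏ i, a (u i)‖
          ≤ ∑ u ∈ (Fintype.piFinset fun _ : Fin k => S).filter (fun u => ∏ i, u i = n), (1 : ℝ) := by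
            refine Finset.sum_le_sum fun u _ => ?_
            rw [norm_prod]
            exact Finset.prod_le_one (fun i _ => norm_nonneg _) fun i _ => ha _
        _ = #((Fintype.piFinset fun _ : Fin k => S).filter (fun u => ∏ i, u i = n)) := by simp
    have hsq : ∀ n ∈ Icc 1 N, ‖c n‖ ^ 2 ≤ k.factorial * ((#(F n) : ℝ) * ((n : ℝ) ^ 2)⁻¹) := by
      intro n hn
      have h1 := hcn n hn
      have h2 := hm n
      have h0 : 0 ≤ (#(F n) : ℝ) * (n : ℝ)⁻¹ := by positivity
      calc ‖c n‖ ^ 2 ≤ (#(F n) * (n : ℝ)⁻¹) ^ 2 := pow_le_pow_left₀ (norm_nonneg _) h1 2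
        _ = #(F n) * (#(F n) * ((n : ℝ) ^ 2)⁻¹) := by ring
        _ ≤ k.factorial * (#(F n) * ((n : ℝ) ^ 2)⁻¹) :=
            mul_le_mul_of_nonneg_right h2 (by positivity)
    calc ∑ n ∈ Icc 1 N, ‖c n‖ ^ 2
        ≤ ∑ n ∈ Icc 1 N, k.factorial * ((#(F n) : ℝ) * ((n : ℝ) ^ 2)⁻¹) := Finset.sum_le_sum hsq
      _ = k.factorial * ∑ u ∈ Fintype.piFinset (fun _ : Fin k => S), (((∏ i, u i : ℕ) : ℝ) ^ 2)⁻¹ := by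
          rw [← Finset.mul_sum, sum_card_fiber_mul k S (fun n => ((n : ℝ) ^ 2)⁻¹) N hprod]
      _ = k.factorial * (∑ p ∈ S, ((p : ℝ) ^ 2)⁻¹) ^ k := by
          congr 1
          have : (∑ p ∈ S, ((p : ℝ) ^ 2)⁻¹) ^ k = ∏ _i : Fin k, ∑ p ∈ S, ((p : ℝ) ^ 2)⁻¹ := by simp
          rw [this, Finset.prod_univ_sum]
          refine Finset.sum_congr rfl fun u _ => ?_
          rw [Nat.cast_prod, ← Finset.prod_pow, ← Finset.prod_inv_distrib]
      _ ≤ k.factorial * (2 / P) ^ k := by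
          gcongr
  -- combine
  have hC₇1 : (1 : ℝ) ≤ C₇ := by rw [hC₇72]; norm_num
  have hC₇0 : (0 : ℝ) ≤ C₇ := by linarith
  have hsum0 : 0 ≤ ∑ n ∈ Icc 1 N, ‖c n‖ ^ 2 := Finset.sum_nonneg fun n _ => by positivity
  have hNle : (N : ℝ) ≤ (2 * P) ^ k := by
    rw [hN]; push_cast
    exact pow_le_pow_left₀ (by positivity) hMle k
  have hlogN : Real.log (2 * N) ≤ 4 * k * Real.log T := by
    have hN0 : (0 : ℝ) < N := by exact_mod_cast hN1
    have h1 : Real.log (2 * N) ≤ Real.log 2 + k * Real.log (2 * P) := by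
      rw [Real.log_mul (by norm_num) hN0.ne', ← Real.log_pow]
      gcongr
    have h2 : Real.log (2 * P) ≤ 2 * Real.log T := by
      have h5 : Real.log (2 * P) ≤ Real.log (T ^ 2) :=
        Real.log_le_log (by linarith) (by nlinarith)
      have h6 : Real.log (T ^ 2) = 2 * Real.log T := by
        rw [Real.log_pow]; push_cast; ring
      linarith
    have h3 : Real.log 2 ≤ Real.log T := (hlogP.trans hlogPT)
    have h4 : (1 : ℝ) ≤ k := by exact_mod_cast hk1
    nlinarith
  have hmain : (#𝒯 : ℝ) * (V ^ (2 * k))⁻¹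
      ≤ C₇ * (2 * 4 ^ k) * (4 * k * Real.log T) * k.factorial := by
    refine hlow.trans (h7'.trans ?_)
    have hTN : 0 ≤ T + N := by positivity
    have hlogN0 : 0 ≤ Real.log (2 * N) := Real.log_nonneg (by
      have : (1:ℝ) ≤ N := by exact_mod_cast hN1
      linarith)
    calc C₇ * (T + N) * Real.log (2 * N) * ∑ n ∈ Icc 1 N, ‖c n‖ ^ 2
        ≤ C₇ * (T + N) * Real.log (2 * N) * (k.factorial * (2 / P) ^ k) :=
          mul_le_mul_of_nonneg_left hcoef (by positivity)
      _ = C₇ * ((T + N) * (2 / P) ^ k) * Real.log (2 * N) * k.factorial := by ring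
      _ ≤ C₇ * (2 * 4 ^ k) * (4 * k * Real.log T) * k.factorial := by
          have hTP : (T + N) * (2 / P) ^ k ≤ 2 * 4 ^ k := by
            rw [div_pow, add_mul]
            have e1 : T * (2 ^ k / P ^ k) ≤ 2 ^ k := by
              rw [mul_div_assoc', div_le_iff₀ (by positivity)]
              nlinarith [pow_pos (show (0:ℝ) < 2 by norm_num) k]
            have e2 : (N : ℝ) * (2 ^ k / P ^ k) ≤ 4 ^ k := by
              calc (N : ℝ) * (2 ^ k / P ^ k) ≤ (2 * P) ^ k * (2 ^ k / P ^ k) := by gcongr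
                _ = 4 ^ k := by
                    rw [mul_pow, show (4 : ℝ) ^ k = 2 ^ k * 2 ^ k by rw [← mul_pow]; norm_num]
                    field_simp
            have e3 : (2 : ℝ) ^ k ≤ 4 ^ k := pow_le_pow_left₀ (by norm_num) (by norm_num) k
            linarith
          gcongr
  -- final absorption
  have hfact : (k.factorial : ℝ) ≤ (k : ℝ) ^ k := by exact_mod_cast Nat.factorial_le_pow k
  have habs := absorb_aux hk1 hk2ρ hρ1 hρT hL1 hLdef.symm hlogT1
  have hV2k : V ^ (2 * k) ≤ V ^ 2 * T ^ (2 * Real.log V / Real.log P) := by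
    have hV0 : 0 < V := by linarith
    have e1 : V ^ (2 * k) = Real.exp (2 * k * Real.log V) := by
      rw [← Real.exp_log (pow_pos hV0 _), Real.log_pow]; push_cast; ring_nf
    have e2 : V ^ 2 * T ^ (2 * Real.log V / Real.log P) = Real.exp (2 * (ρ + 1) * Real.log V) := by
      rw [Real.rpow_def_of_pos hT0, ← Real.exp_log (pow_pos hV0 2), Real.log_pow, ← Real.exp_add]
      congr 1
      rw [hρ]; push_cast; field_simp; ring
    rw [e1, e2, Real.exp_le_exp]
    have := Real.log_nonneg hV
    nlinarith
  have hVpos : 0 < V ^ (2 * k) := by positivity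
  have step1 : (#𝒯 : ℝ) ≤ V ^ (2 * k) * (C₇ * (2 * 4 ^ k) * (4 * k * Real.log T) * k.factorial) := by
    have h := hmain
    rw [← div_eq_mul_inv, div_le_iff₀ hVpos] at h
    calc (#𝒯 : ℝ) ≤ C₇ * (2 * 4 ^ k) * (4 * k * Real.log T) * k.factorial * V ^ (2 * k) := h
      _ = _ := mul_comm _ _
  have step2 : C₇ * (2 * 4 ^ k) * (4 * k * Real.log T) * (k.factorial : ℝ)
      ≤ 8 * C₇ * Real.exp (16 * ρ * L) := by
    have h1 : C₇ * (2 * 4 ^ k) * (4 * k * Real.log T) * (k.factorial : ℝ)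
        ≤ C₇ * (2 * 4 ^ k) * (4 * k * Real.log T) * (k : ℝ) ^ k :=
      mul_le_mul_of_nonneg_left hfact (by positivity)
    refine h1.trans ?_
    calc C₇ * (2 * 4 ^ k) * (4 * k * Real.log T) * (k : ℝ) ^ k
        = 8 * C₇ * ((4 : ℝ) ^ k * k * (k : ℝ) ^ k * Real.log T) := by ring
      _ ≤ 8 * C₇ * Real.exp (16 * ρ * L) :=
          mul_le_mul_of_nonneg_left habs (by positivity)
  calc (#𝒯 : ℝ) ≤ V ^ (2 * k) * (8 * C₇ * Real.exp (16 * ρ * L)) :=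
        step1.trans (mul_le_mul_of_nonneg_left step2 hVpos.le)
    _ ≤ (V ^ 2 * T ^ (2 * Real.log V / Real.log P)) * (8 * C₇ * Real.exp (16 * ρ * L)) :=
        mul_le_mul_of_nonneg_right hV2k (by positivity)
    _ = 576 * V ^ 2 * T ^ (2 * Real.log V / Real.log P)
          * Real.exp (16 * (Real.log T / Real.log P) * Real.log (Real.log T)) := by
        rw [hC₇72, ← hρ, ← hLdef]; ring

end Literature.NumberTheory.Sieve.Lichtman2020

namespace Literature.NumberTheory.Sieve.Lichtman2020

open Literature.NumberTheory.LFunctions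

/-! ### Windowed Dirichlet polynomials `∑_{M ≤ m ≤ N} w_m m^{-1-it}` as standard ones -/

/-- The coefficients `β_n = 𝟙_{n ≥ M} w_n / n` of the standard form. [folklore] -/
def stdCoeff (w : ℕ → ℂ) (M : ℕ) (n : ℕ) : ℂ := if M ≤ n then w n * (n : ℂ)⁻¹ else 0

/-- `∑_{M ≤ m ≤ N} w_m m^{-1-it} = ∑_{1 ≤ n ≤ N} β_n n^{-it}` for `M ≥ 1`. [folklore] -/
theorem sum_Icc_eq_stdForm (w : ℕ → ℂ) {M : ℕ} (hM : 1 ≤ M) (N : ℕ) (t : ℝ) :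
    ∑ m ∈ Icc M N, w m * (m : ℂ) ^ (-(1 + (t : ℂ) * I)) =
      ∑ n ∈ Icc 1 N, stdCoeff w M n * (n : ℂ) ^ (-((t : ℂ) * I)) := by
  have hsub : Icc M N = (Icc 1 N).filter (fun n => M ≤ n) := by
    ext n; simp only [Finset.mem_Icc, Finset.mem_filter]; omega
  rw [hsub, Finset.sum_filter]
  refine Finset.sum_congr rfl fun n hn => ?_
  have hn0 : (n : ℂ) ≠ 0 := by
    have : 1 ≤ n := (Finset.mem_Icc.mp hn).1
    exact_mod_cast (show n ≠ 0 by omega)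
  unfold stdCoeff
  split_ifs with h
  · rw [neg_add, Complex.cpow_add _ _ hn0, Complex.cpow_neg_one]; ring
  · simp

/-- `∑_{1 ≤ n ≤ N} ‖β_n‖² ≤ 2/M` when `‖w‖ ≤ 1`, `M ≥ 1` and `N ≤ 2M`. [folklore] -/
theorem sum_norm_sq_stdCoeff_le {w : ℕ → ℂ} (hw : ∀ m, ‖w m‖ ≤ 1) {M N : ℕ} (hM : 1 ≤ M)
    (hN : N ≤ 2 * M) :
    ∑ n ∈ Icc 1 N, ‖stdCoeff w M n‖ ^ 2 ≤ 2 / M := by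
  have hM0 : (0 : ℝ) < M := by exact_mod_cast hM
  have hterm : ∀ n ∈ Icc 1 N, ‖stdCoeff w M n‖ ^ 2 ≤ if M ≤ n then ((M : ℝ) ^ 2)⁻¹ else 0 := by
    intro n hn
    unfold stdCoeff
    split_ifs with h
    · have hn0 : (0 : ℝ) < n := by exact_mod_cast (show 0 < n by omega)
      rw [norm_mul, norm_inv, Complex.norm_natCast, mul_pow, inv_pow]
      have h1 : ‖w n‖ ^ 2 ≤ 1 := by
        have := hw n
        have := norm_nonneg (w n)
        nlinarith
      have h2 : ((n : ℝ) ^ 2)⁻¹ ≤ ((M : ℝ) ^ 2)⁻¹ := by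
        have : (M : ℝ) ≤ n := by exact_mod_cast h
        gcongr
      calc ‖w n‖ ^ 2 * ((n : ℝ) ^ 2)⁻¹ ≤ 1 * ((M : ℝ) ^ 2)⁻¹ := by gcongr
        _ = ((M : ℝ) ^ 2)⁻¹ := one_mul _
    · simp
  refine (Finset.sum_le_sum hterm).trans ?_
  rw [Finset.sum_ite, Finset.sum_const_zero, add_zero, Finset.sum_const, nsmul_eq_mul]
  have hcard : (#((Icc 1 N).filter (fun n => M ≤ n)) : ℝ) ≤ M + 1 := by
    have h1 : (Icc 1 N).filter (fun n => M ≤ n) ⊆ Icc M (2 * M) := by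
      intro n hn
      simp only [Finset.mem_filter, Finset.mem_Icc] at hn ⊢; omega
    have h2 := Finset.card_le_card h1
    rw [Nat.card_Icc] at h2
    have h3 : ((#((Icc 1 N).filter (fun n => M ≤ n)) : ℕ) : ℝ) ≤ ((2 * M + 1 - M : ℕ) : ℝ) := by
      exact_mod_cast h2
    refine h3.trans ?_
    rw [Nat.cast_sub (by omega)]; push_cast; linarith
  calc (#((Icc 1 N).filter (fun n => M ≤ n)) : ℝ) * ((M : ℝ) ^ 2)⁻¹ ≤ (M + 1) * ((M : ℝ) ^ 2)⁻¹ := by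
        gcongr
    _ ≤ 2 / M := by
        rw [div_eq_mul_inv, show ((M : ℝ) ^ 2)⁻¹ = (M : ℝ)⁻¹ * (M : ℝ)⁻¹ by rw [sq, mul_inv]]
        have h1 : (1 : ℝ) ≤ M := by exact_mod_cast hM
        have : (M + 1) * ((M : ℝ)⁻¹ * (M : ℝ)⁻¹) = ((M + 1) / M) * (M : ℝ)⁻¹ := by
          field_simp
        rw [this]
        refine mul_le_mul_of_nonneg_right ?_ (by positivity)
        rw [div_le_iff₀ hM0]; linarith

/-- **Mean value bound for a windowed polynomial**: for `‖w‖ ≤ 1`, `1 ≤ M`, `N ≤ 2M`, `T > 0`,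
`∫_{-T}^{T} |∑_{M ≤ m ≤ N} w_m m^{-1-it}|² dt ≤ 10 T/M + 72` (the tree's weak mean value theorem
`dirichletPolynomial_meanSquare_le`, Lichtman's Lemma 4.1). [cite: Lichtman2020, Lemma 4.1] -/
theorem intervalIntegral_norm_sq_window_le {w : ℕ → ℂ} (hw : ∀ m, ‖w m‖ ≤ 1) {M N : ℕ}
    (hM : 1 ≤ M) (hN : N ≤ 2 * M) {T : ℝ} (hT : 0 < T) :
    ∫ t in -T..T, ‖∑ m ∈ Icc M N, w m * (m : ℂ) ^ (-(1 + (t : ℂ) * I))‖ ^ 2 ≤ 10 * T / M + 72 := by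
  have hM0 : (0 : ℝ) < M := by exact_mod_cast hM
  simp_rw [sum_Icc_eq_stdForm w hM N]
  refine (dirichletPolynomial_meanSquare_le (stdCoeff w M) N hT).trans ?_
  have h1 := sum_norm_sq_stdCoeff_le hw hM hN
  have hNM : (N : ℝ) ≤ 2 * M := by exact_mod_cast hN
  calc (5 * T + 18 * N) * ∑ n ∈ Icc 1 N, ‖stdCoeff w M n‖ ^ 2 ≤ (5 * T + 18 * (2 * M)) * (2 / M) := by
        gcongr
    _ = 10 * T / M + 72 := by field_simp; ring

/-- **Halász–Montgomery bound for a windowed polynomial at well-spaced points** (from the named fact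
`MatomakiRadziwill2016_lemma9`, Lichtman's Lemma 4.3): for `‖w‖ ≤ 1`, `1 ≤ M`, `N ≤ 2M`, `N ≥ 1`,
`T ≥ 1` and a well-spaced `𝒲 ⊂ [-T, T]`,
`∑_{t ∈ 𝒲} |∑_{M ≤ m ≤ N} w_m m^{-1-it}|² ≤ C₉ (N + #𝒲 √T) log(2T) · 2/M`.
[cite: Lichtman2020, Lemma 4.3] -/
theorem sum_norm_sq_window_le_of_lemma9 {C₉ : ℝ}
    (h9 : ∀ (N : ℕ) (a : ℕ → ℂ) (T : ℝ) (𝒯 : Finset ℝ), 1 ≤ N → 1 ≤ T →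
      (∀ t ∈ 𝒯, |t| ≤ T) → (∀ t ∈ 𝒯, ∀ t' ∈ 𝒯, t ≠ t' → 1 ≤ |t - t'|) →
      ∑ t ∈ 𝒯, ‖∑ n ∈ Finset.Icc 1 N, a n * (n : ℂ) ^ (-((t : ℂ) * I))‖ ^ 2 ≤
        C₉ * (N + 𝒯.card * Real.sqrt T) * Real.log (2 * T) * ∑ n ∈ Finset.Icc 1 N, ‖a n‖ ^ 2)
    {w : ℕ → ℂ} (hw : ∀ m, ‖w m‖ ≤ 1) {M N : ℕ} (hM : 1 ≤ M) (hN : N ≤ 2 * M) (hN1 : 1 ≤ N)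
    {T : ℝ} (hT : 1 ≤ T) (𝒲 : Finset ℝ) (h𝒲T : ∀ t ∈ 𝒲, |t| ≤ T)
    (hws : ∀ t ∈ 𝒲, ∀ t' ∈ 𝒲, t ≠ t' → 1 ≤ |t - t'|) :
    ∑ t ∈ 𝒲, ‖∑ m ∈ Icc M N, w m * (m : ℂ) ^ (-(1 + (t : ℂ) * I))‖ ^ 2 ≤
      max C₉ 0 * ((N : ℝ) + #𝒲 * Real.sqrt T) * Real.log (2 * T) * (2 / M) := by
  simp_rw [sum_Icc_eq_stdForm w hM N]
  refine (h9 N (stdCoeff w M) T 𝒲 hN1 hT h𝒲T hws).trans ?_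
  have h1 := sum_norm_sq_stdCoeff_le hw hM hN
  have hlog : 0 ≤ Real.log (2 * T) := Real.log_nonneg (by linarith)
  have h0 : 0 ≤ ((N : ℝ) + #𝒲 * Real.sqrt T) * Real.log (2 * T) := by positivity
  have hs0 : 0 ≤ ∑ n ∈ Icc 1 N, ‖stdCoeff w M n‖ ^ 2 := Finset.sum_nonneg fun _ _ => by positivity
  calc C₉ * ((N : ℝ) + #𝒲 * Real.sqrt T) * Real.log (2 * T) * ∑ n ∈ Icc 1 N, ‖stdCoeff w M n‖ ^ 2
      ≤ max C₉ 0 * ((N : ℝ) + #𝒲 * Real.sqrt T) * Real.log (2 * T)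
          * ∑ n ∈ Icc 1 N, ‖stdCoeff w M n‖ ^ 2 := by
        gcongr; exact le_max_left _ _
    _ ≤ max C₉ 0 * ((N : ℝ) + #𝒲 * Real.sqrt T) * Real.log (2 * T) * (2 / M) := by
        gcongr

/-! ### The cofactor polynomial of Lemma 12 as a windowed polynomial -/

/-- The weights `b_m/(ω(m)+1)` of `blockCofactorPoly` are bounded by `1` if `‖b‖ ≤ 1`. [folklore] -/
theorem norm_div_primeDivisorsIn_le {b : ℕ → ℂ} (hb : ∀ m, ‖b m‖ ≤ 1) (P Q : ℝ) (m : ℕ) :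
    ‖b m / ((primeDivisorsIn P Q m : ℂ) + 1)‖ ≤ 1 := by
  rw [norm_div]
  have h1 : (1 : ℝ) ≤ ‖((primeDivisorsIn P Q m : ℂ) + 1)‖ := by
    have : ((primeDivisorsIn P Q m : ℂ) + 1) = ((primeDivisorsIn P Q m + 1 : ℕ) : ℂ) := by push_cast; ring
    rw [this, Complex.norm_natCast]
    exact_mod_cast Nat.le_add_left 1 _
  calc ‖b m‖ / ‖((primeDivisorsIn P Q m : ℂ) + 1)‖ ≤ 1 / 1 := by
        gcongr; exact hb m
    _ = 1 := by norm_num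

/-- `blockCofactorPoly b X P Q H v t = ∑_{M ≤ m ≤ N} w_m m^{-1-it}` with `w_m = b_m/(ω(m)+1)`,
`M = ⌈X e^{-v/H}⌉`, `N = ⌊2X e^{-v/H}⌋`. [cite: MatomakiRadziwillAnnals2016, Lemma 12] -/
theorem blockCofactorPoly_eq_window (b : ℕ → ℂ) (X P Q H : ℝ) (v : ℕ) (t : ℝ) :
    blockCofactorPoly b X P Q H v t =
      ∑ m ∈ Icc ⌈X * Real.exp (-(v / H))⌉₊ ⌊2 * X * Real.exp (-(v / H))⌋₊,
        (b m / ((primeDivisorsIn P Q m : ℂ) + 1)) * (m : ℂ) ^ (-(1 + (t : ℂ) * I)) := by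
  unfold blockCofactorPoly
  refine Finset.sum_congr rfl fun m _ => ?_
  ring

/-- The window `[⌈y⌉, ⌊2y⌋]` has `⌈y⌉ ≥ 1` and `⌊2y⌋ ≤ 2⌈y⌉` for `y > 0`. [folklore] -/
theorem window_bounds {y : ℝ} (hy : 0 < y) : 1 ≤ ⌈y⌉₊ ∧ ⌊2 * y⌋₊ ≤ 2 * ⌈y⌉₊ := by
  refine ⟨Nat.one_le_iff_ne_zero.mpr (Nat.ceil_pos.mpr hy).ne', ?_⟩
  have h1 : (⌊2 * y⌋₊ : ℝ) ≤ 2 * y := Nat.floor_le (by linarith)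
  have h2 : y ≤ ⌈y⌉₊ := Nat.le_ceil y
  exact_mod_cast (show (⌊2 * y⌋₊ : ℝ) ≤ 2 * ⌈y⌉₊ by linarith)

/-! ### A geometric tail -/

/-- `∑_{v₀ ≤ v ≤ v₁} e^{-s v} ≤ e^{-s v₀} (1 + 1/s)` for `s > 0`. [folklore] -/
theorem sum_exp_neg_mul_le {s : ℝ} (hs : 0 < s) (v₀ v₁ : ℕ) :
    ∑ v ∈ Icc v₀ v₁, Real.exp (-(s * v)) ≤ Real.exp (-(s * v₀)) * (1 + 1 / s) := by
  have hr0 : 0 ≤ Real.exp (-s) := (Real.exp_pos _).le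
  have hr1 : Real.exp (-s) < 1 := Real.exp_lt_one_iff.mpr (by linarith)
  have hterm : ∀ v : ℕ, Real.exp (-(s * v)) = Real.exp (-s) ^ v := fun v => by
    rw [← Real.exp_nat_mul]; ring_nf
  simp_rw [hterm]
  have hIcc : Icc v₀ v₁ = Ico v₀ (v₁ + 1) := by ext v; simp
  rw [hIcc]
  refine (geom_sum_Ico_le_of_lt_one hr0 hr1).trans ?_
  rw [div_eq_mul_inv]
  refine mul_le_mul_of_nonneg_left ?_ (pow_nonneg hr0 _)
  -- `1/(1 - e^{-s}) ≤ 1 + 1/s` since `1 - e^{-s} ≥ s/(1+s)`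
  have h1 : 1 + s ≤ Real.exp s := by have := Real.add_one_le_exp s; linarith
  have h2 : Real.exp (-s) * Real.exp s = 1 := by rw [← Real.exp_add]; simp
  have h3 : 0 < 1 - Real.exp (-s) := by linarith
  rw [inv_le_comm₀ h3 (by positivity)]
  have h4 : (1 + 1 / s)⁻¹ = s / (1 + s) := by field_simp; ring
  rw [h4, div_le_iff₀ (by linarith)]
  nlinarith [Real.exp_pos (-s), Real.exp_pos s]

end Literature.NumberTheory.Sieve.Lichtman2020

namespace Literature.NumberTheory.Sieve.Lichtman2020

/-! ### Continuity of the block polynomials in `t` -/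

/-- `t ↦ Q_{v,H}(1+it)` is continuous. [folklore] -/
theorem continuous_blockPrimePoly (c : ℕ → ℂ) (P Q H : ℝ) (v : ℕ) :
    Continuous fun t : ℝ => blockPrimePoly c P Q H v t := by
  unfold blockPrimePoly; exact MatomakiRadziwillLemma12.continuous_dsum _ _

/-- `t ↦ R_{v,H}(1+it)` is continuous. [folklore] -/
theorem continuous_blockCofactorPoly (b : ℕ → ℂ) (X P Q H : ℝ) (v : ℕ) :
    Continuous fun t : ℝ => blockCofactorPoly b X P Q H v t := by
  have : (fun t : ℝ => blockCofactorPoly b X P Q H v t) = fun t : ℝ =>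
      ∑ m ∈ Icc ⌈X * Real.exp (-(v / H))⌉₊ ⌊2 * X * Real.exp (-(v / H))⌋₊,
        (b m / ((primeDivisorsIn P Q m : ℂ) + 1)) * (m : ℂ) ^ (-(1 + (t : ℂ) * I)) := by
    funext t
    unfold blockCofactorPoly
    refine Finset.sum_congr rfl fun m _ => ?_
    ring
  rw [this]; exact MatomakiRadziwillLemma12.continuous_dsum _ _

/-! ### The prime block as a dyadic prime polynomial and as an interval prime polynomial -/

/-- The prime block `{P ≤ p ≤ Q prime : e^{v/H} ≤ p < e^{(v+1)/H}}`. [cite: MatomakiRadziwillAnnals2016, Lemma 12] -/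
def primeBlock (P Q H : ℝ) (v : ℕ) : Finset ℕ :=
  ((Icc ⌈P⌉₊ ⌊Q⌋₊).filter Nat.Prime).filter
    (fun p : ℕ => Real.exp (v / H) ≤ p ∧ (p : ℝ) < Real.exp ((v + 1) / H))

/-- Unfolding `blockPrimePoly` over `primeBlock`. [folklore] -/
theorem blockPrimePoly_eq_sum_primeBlock (c : ℕ → ℂ) (P Q H : ℝ) (v : ℕ) (t : ℝ) :
    blockPrimePoly c P Q H v t = ∑ p ∈ primeBlock P Q H v, c p * (p : ℂ) ^ (-(1 + (t : ℂ) * I)) := rfl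

/-- Members of the block are primes in `[e^{v/H}, e^{(v+1)/H})` and in `[P, Q]`. [folklore] -/
theorem mem_primeBlock {P Q H : ℝ} {v p : ℕ} (hp : p ∈ primeBlock P Q H v) :
    p.Prime ∧ P ≤ p ∧ (p : ℝ) ≤ Q ∧ Real.exp (v / H) ≤ p ∧ (p : ℝ) < Real.exp ((v + 1) / H) := by
  simp only [primeBlock, Finset.mem_filter, Finset.mem_Icc] at hp
  obtain ⟨⟨⟨h1, h2⟩, h3⟩, h4, h5⟩ := hp
  refine ⟨h3, ?_, ?_, h4, h5⟩
  · exact (Nat.ceil_le.mp h1)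
  · have hQ : 0 ≤ Q := by
      by_contra hQ
      push Not at hQ
      have : ⌊Q⌋₊ = 0 := Nat.floor_of_nonpos hQ.le
      rw [this] at h2
      exact absurd (Nat.le_zero.mp h2 ▸ h3) Nat.not_prime_zero
    exact (Nat.le_floor_iff hQ).mp h2

/-- For `H ≥ 2` the block lies in the dyadic range `[⌈L⌉, ⌊2L⌋]`, `L = e^{v/H}`. [folklore] -/
theorem primeBlock_subset_dyadic {P Q H : ℝ} (hH : 2 ≤ H) (v : ℕ) :
    primeBlock P Q H v ⊆ (Icc ⌈Real.exp (v / H)⌉₊ ⌊2 * Real.exp (v / H)⌋₊).filter Nat.Prime := by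
  intro p hp
  obtain ⟨hpr, -, -, h4, h5⟩ := mem_primeBlock hp
  have hH0 : 0 < H := by linarith
  have he : Real.exp ((v + 1) / H) ≤ 2 * Real.exp (v / H) := by
    rw [add_div, Real.exp_add, mul_comm]
    refine mul_le_mul_of_nonneg_right ?_ (Real.exp_pos _).le
    have h1 : 1 / H ≤ Real.log 2 := by
      have hl : (1 : ℝ) / 2 ≤ Real.log 2 := by
        have := Real.add_one_le_exp (Real.log 2)
        rw [Real.exp_log (by norm_num)] at this
        by_contra hcon
        push Not at hcon
        have h1 : Real.exp (Real.log 2) < Real.exp (1 / 2) := Real.exp_lt_exp.mpr hcon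
        rw [Real.exp_log (by norm_num)] at h1
        have h2 : Real.exp (1 / 2 : ℝ) ≤ 2 := by
          have h3 : Real.exp (1 / 2 : ℝ) ^ 2 = Real.exp 1 := by
            rw [← Real.exp_nat_mul]; norm_num
          nlinarith [Real.exp_one_lt_d9, Real.exp_pos (1 / 2 : ℝ)]
        linarith
      calc 1 / H ≤ 1 / 2 := by gcongr
        _ ≤ Real.log 2 := hl
    calc Real.exp (1 / H) ≤ Real.exp (Real.log 2) := Real.exp_le_exp.mpr h1
      _ = 2 := Real.exp_log (by norm_num)
  simp only [Finset.mem_filter, Finset.mem_Icc]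
  refine ⟨⟨Nat.ceil_le.mpr h4, Nat.le_floor ?_⟩, hpr⟩
  linarith

/-- `Q_{v,H}(1+it)` as a dyadic prime polynomial with coefficients `a_p = 𝟙_{block}(p) c_p`
(the shape of Matomäki–Radziwiłł's Lemma 8), for `H ≥ 2`. [folklore] -/
theorem blockPrimePoly_eq_dyadic (c : ℕ → ℂ) {P Q H : ℝ} (hH : 2 ≤ H) (v : ℕ) (t : ℝ) :
    blockPrimePoly c P Q H v t =
      ∑ p ∈ (Icc ⌈Real.exp (v / H)⌉₊ ⌊2 * Real.exp (v / H)⌋₊).filter Nat.Prime,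
        (if p ∈ primeBlock P Q H v then c p else 0) * (p : ℂ) ^ (-(1 + (t : ℂ) * I)) := by
  rw [blockPrimePoly_eq_sum_primeBlock]
  rw [← Finset.sum_subset (primeBlock_subset_dyadic hH v) (f := fun p =>
      (if p ∈ primeBlock P Q H v then c p else 0) * (p : ℂ) ^ (-(1 + (t : ℂ) * I)))]
  · refine Finset.sum_congr rfl fun p hp => ?_
    rw [if_pos hp]
  · intro p _ hp
    rw [if_neg hp, zero_mul]

/-- The block is the set of primes of a closed real interval `[P', Q']`,
`P' = max(P, e^{v/H})`, `Q' = min(Q, ⌈e^{(v+1)/H}⌉ - 1)`. [folklore] -/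
theorem primeBlock_eq_interval (P Q H : ℝ) (v : ℕ) :
    primeBlock P Q H v =
      (Icc ⌈max P (Real.exp (v / H))⌉₊
          ⌊min Q ((⌈Real.exp ((v + 1) / H)⌉₊ : ℝ) - 1)⌋₊).filter Nat.Prime := by
  ext p
  simp only [primeBlock, Finset.mem_filter, Finset.mem_Icc]
  set E := Real.exp ((v + 1) / H) with hE
  have hE0 : 0 < E := Real.exp_pos _
  have hE1 : 1 ≤ ⌈E⌉₊ := Nat.one_le_iff_ne_zero.mpr (Nat.ceil_pos.mpr hE0).ne'
  -- `p < E ↔ p ≤ ⌈E⌉ - 1`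
  have hlt : ∀ p : ℕ, (p : ℝ) < E ↔ (p : ℝ) ≤ (⌈E⌉₊ : ℝ) - 1 := by
    intro p
    constructor
    · intro h
      have h1 : p < ⌈E⌉₊ := Nat.lt_ceil.mpr h
      have h2 : p ≤ ⌈E⌉₊ - 1 := by omega
      have h3 : ((p : ℕ) : ℝ) ≤ ((⌈E⌉₊ - 1 : ℕ) : ℝ) := by exact_mod_cast h2
      rwa [Nat.cast_sub hE1, Nat.cast_one] at h3
    · intro h
      have h2 : ((p : ℕ) : ℝ) ≤ ((⌈E⌉₊ - 1 : ℕ) : ℝ) := by rwa [Nat.cast_sub hE1, Nat.cast_one]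
      have h3 : p ≤ ⌈E⌉₊ - 1 := by exact_mod_cast h2
      have h4 : p < ⌈E⌉₊ := by omega
      exact Nat.lt_ceil.mp h4
  constructor
  · rintro ⟨⟨⟨h1, h2⟩, h3⟩, h4, h5⟩
    have hp0 : (0 : ℝ) ≤ p := Nat.cast_nonneg p
    refine ⟨⟨Nat.ceil_le.mpr (max_le (Nat.ceil_le.mp h1) h4), Nat.le_floor ?_⟩, h3⟩
    refine le_min ?_ ((hlt p).mp h5)
    have hQ : 0 ≤ Q := by
      by_contra hQ
      push Not at hQ
      have : ⌊Q⌋₊ = 0 := Nat.floor_of_nonpos hQ.le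
      rw [this] at h2
      exact absurd (Nat.le_zero.mp h2 ▸ h3) Nat.not_prime_zero
    exact (Nat.le_floor_iff hQ).mp h2
  · rintro ⟨⟨h1, h2⟩, h3⟩
    have hmax := Nat.ceil_le.mp h1
    have hp1 : (1 : ℝ) ≤ p := by exact_mod_cast h3.one_lt.le
    have hmin0 : 0 ≤ min Q ((⌈E⌉₊ : ℝ) - 1) := by
      by_contra hneg
      push Not at hneg
      have : ⌊min Q ((⌈E⌉₊ : ℝ) - 1)⌋₊ = 0 := Nat.floor_of_nonpos hneg.le
      rw [this] at h2
      exact absurd (Nat.le_zero.mp h2 ▸ h3) Nat.not_prime_zero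
    have hmin := (Nat.le_floor_iff hmin0).mp h2
    refine ⟨⟨⟨Nat.ceil_le.mpr ((le_max_left _ _).trans hmax), Nat.le_floor
      (hmin.trans (min_le_left _ _))⟩, h3⟩, (le_max_right _ _).trans hmax, (hlt p).mpr
      (hmin.trans (min_le_right _ _))⟩

/-- The endpoints of `primeBlock_eq_interval`: `P ≤ P'` and `Q' ≤ Q`. [folklore] -/
theorem interval_endpoints_bounds (P Q H : ℝ) (v : ℕ) :
    P ≤ max P (Real.exp (v / H)) ∧ min Q ((⌈Real.exp ((v + 1) / H)⌉₊ : ℝ) - 1) ≤ Q :=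
  ⟨le_max_left _ _, min_le_left _ _⟩

/-! ### Unit-interval discretisation of `t`-integrals -/

/-- `∫_{T₀}^{T} f ≤ ∑_{n=⌊T₀⌋}^{⌊T⌋} ∫_n^{n+1} f` for continuous `f ≥ 0` and `0 ≤ T₀ ≤ T`. [folklore] -/
theorem intervalIntegral_le_sum_unit {f : ℝ → ℝ} (hf : Continuous f) (hf0 : ∀ t, 0 ≤ f t)
    {T₀ T : ℝ} (hT₀ : 0 ≤ T₀) (hT : T₀ ≤ T) :
    ∫ t in T₀..T, f t ≤ ∑ n ∈ Finset.Ico ⌊T₀⌋₊ (⌊T⌋₊ + 1), ∫ t in (n : ℝ)..((n + 1 : ℕ) : ℝ), f t := by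
  have h1 : ∫ t in T₀..T, f t ≤ ∫ t in ((⌊T₀⌋₊ : ℕ) : ℝ)..((⌊T⌋₊ + 1 : ℕ) : ℝ), f t := by
    refine intervalIntegral.integral_mono_interval (Nat.floor_le hT₀) hT ?_
      (Filter.Eventually.of_forall hf0) (hf.intervalIntegrable _ _)
    push_cast
    exact (Nat.lt_floor_add_one T).le
  refine h1.trans (le_of_eq ?_)
  symm
  have hmn : ⌊T₀⌋₊ ≤ ⌊T⌋₊ + 1 := (Nat.floor_mono hT).trans (Nat.le_succ _)
  exact intervalIntegral.sum_integral_adjacent_intervals_Ico (a := fun n : ℕ => (n : ℝ)) hmn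
    (fun k _ => hf.intervalIntegrable _ _)

/-- The union of the unit intervals indexed by `G`. [folklore] -/
def unitUnion (G : Finset ℕ) : Set ℝ := ⋃ n ∈ G, Set.Ico (n : ℝ) (n + 1)

/-- `unitUnion G` is measurable. [folklore] -/
theorem measurableSet_unitUnion (G : Finset ℕ) : MeasurableSet (unitUnion G) :=
  Finset.measurableSet_biUnion _ fun _ _ => measurableSet_Ico

/-- `unitUnion G ⊆ [a, b+1]` if `G ⊆ [a, b]`. [folklore] -/
theorem unitUnion_subset_Icc {G : Finset ℕ} {a b : ℕ} (hG : ∀ n ∈ G, a ≤ n ∧ n ≤ b) :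
    unitUnion G ⊆ Set.Icc (a : ℝ) (b + 1) := by
  intro t ht
  simp only [unitUnion, Set.mem_iUnion, Set.mem_Ico] at ht
  obtain ⟨n, hn, h1, h2⟩ := ht
  obtain ⟨ha, hb⟩ := hG n hn
  constructor
  · calc (a : ℝ) ≤ n := by exact_mod_cast ha
      _ ≤ t := h1
  · have : (n : ℝ) ≤ b := by exact_mod_cast hb
    linarith

/-- A point of `unitUnion G` lies in `[n, n+1]` for some `n ∈ G`. [folklore] -/
theorem exists_mem_of_mem_unitUnion {G : Finset ℕ} {t : ℝ} (ht : t ∈ unitUnion G) :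
    ∃ n ∈ G, (n : ℝ) ≤ t ∧ t ≤ n + 1 := by
  simp only [unitUnion, Set.mem_iUnion, Set.mem_Ico] at ht
  obtain ⟨n, hn, h1, h2⟩ := ht
  exact ⟨n, hn, h1, h2.le⟩

/-- `∫_{unitUnion G} f = ∑_{n ∈ G} ∫_n^{n+1} f` for continuous `f`. [folklore] -/
theorem setIntegral_unitUnion {f : ℝ → ℝ} (hf : Continuous f) (G : Finset ℕ) :
    ∫ t in unitUnion G, f t = ∑ n ∈ G, ∫ t in (n : ℝ)..((n + 1 : ℕ) : ℝ), f t := by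
  unfold unitUnion
  rw [MeasureTheory.integral_biUnion_finset]
  · refine Finset.sum_congr rfl fun n _ => ?_
    rw [intervalIntegral.integral_of_le (by push_cast; linarith),
      MeasureTheory.integral_Ico_eq_integral_Ioc]
    push_cast; rfl
  · exact fun _ _ => measurableSet_Ico
  · intro m _ n _ hmn
    change Disjoint (Set.Ico (m : ℝ) (m + 1)) (Set.Ico (n : ℝ) (n + 1))
    rw [Set.Ico_disjoint_Ico]
    rcases lt_or_gt_of_ne hmn with h | h
    · have : (m : ℝ) + 1 ≤ n := by exact_mod_cast h
      calc min ((m : ℝ) + 1) (n + 1) ≤ m + 1 := min_le_left _ _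
        _ ≤ n := this
        _ ≤ max (m : ℝ) n := le_max_right _ _
    · have : (n : ℝ) + 1 ≤ m := by exact_mod_cast h
      calc min ((m : ℝ) + 1) (n + 1) ≤ n + 1 := min_le_right _ _
        _ ≤ m := this
        _ ≤ max (m : ℝ) n := le_max_left _ _
  · exact fun _ _ => (hf.integrableOn_Icc).mono_set Set.Ico_subset_Icc_self

/-- `∫_n^{n+1} q r ≤ A B` if `0 ≤ q ≤ A` and `0 ≤ r ≤ B` on `[n, n+1]` (continuous `q, r`). [folklore] -/
theorem intervalIntegral_unit_mul_le {q r : ℝ → ℝ} (hq : Continuous q) (hr : Continuous r)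
    (n : ℕ) {A B : ℝ} (hq0 : ∀ t, 0 ≤ q t) (hr0 : ∀ t, 0 ≤ r t)
    (hA : ∀ t ∈ Set.Icc (n : ℝ) (n + 1), q t ≤ A) (hB : ∀ t ∈ Set.Icc (n : ℝ) (n + 1), r t ≤ B) :
    ∫ t in (n : ℝ)..((n + 1 : ℕ) : ℝ), q t * r t ≤ A * B := by
  have hle : (n : ℝ) ≤ ((n + 1 : ℕ) : ℝ) := by push_cast; linarith
  have h1 : ∫ t in (n : ℝ)..((n + 1 : ℕ) : ℝ), q t * r t ≤ ∫ _ in (n : ℝ)..((n + 1 : ℕ) : ℝ), A * B := by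
    refine intervalIntegral.integral_mono_on hle ((hq.mul hr).intervalIntegrable _ _)
      (intervalIntegrable_const) fun t ht => ?_
    have ht' : t ∈ Set.Icc (n : ℝ) (n + 1) := by
      simpa using ht
    exact mul_le_mul (hA t ht') (hB t ht') (hr0 t) ((hq0 t).trans (hA t ht'))
  refine h1.trans (le_of_eq ?_)
  rw [intervalIntegral.integral_const]; push_cast; simp

/-- A continuous function attains its maximum on `[n, n+1]`. [folklore] -/
theorem exists_max_unit {g : ℝ → ℝ} (hg : Continuous g) (n : ℕ) :
    ∃ t ∈ Set.Icc (n : ℝ) (n + 1), ∀ s ∈ Set.Icc (n : ℝ) (n + 1), g s ≤ g t := by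
  obtain ⟨t, ht, hmax⟩ := (isCompact_Icc (a := (n : ℝ)) (b := n + 1)).exists_isMaxOn
    (Set.nonempty_Icc.mpr (by linarith)) hg.continuousOn
  exact ⟨t, ht, fun s hs => hmax hs⟩

/-! ### Points in alternate unit intervals are well spaced -/

/-- If `t n ∈ [n, n+1]` then points attached to distinct `n` of the same parity are `≥ 1` apart,
so `n ↦ t n` is injective on each parity class. [folklore] -/
theorem abs_sub_ge_one_of_parity {t : ℕ → ℝ} {B : Finset ℕ} (ht : ∀ n ∈ B, (n : ℝ) ≤ t n ∧ t n ≤ n + 1)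
    {r : ℕ} {m n : ℕ} (hm : m ∈ B.filter (fun k => k % 2 = r)) (hn : n ∈ B.filter (fun k => k % 2 = r))
    (hmn : m ≠ n) : 1 ≤ |t m - t n| := by
  rw [Finset.mem_filter] at hm hn
  obtain ⟨hm1, hm2⟩ := ht m hm.1
  obtain ⟨hn1, hn2⟩ := ht n hn.1
  have hpar : m % 2 = n % 2 := by rw [hm.2, hn.2]
  rcases lt_or_gt_of_ne hmn with h | h
  · have h2 : m + 2 ≤ n := by omega
    have : (m : ℝ) + 2 ≤ n := by exact_mod_cast h2
    rw [abs_sub_comm, abs_of_nonneg (by linarith)]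
    linarith
  · have h2 : n + 2 ≤ m := by omega
    have : (n : ℝ) + 2 ≤ m := by exact_mod_cast h2
    rw [abs_of_nonneg (by linarith)]
    linarith

/-- The image `𝒲_r = {t n : n ∈ B, n ≡ r (2)}` is well spaced, has the cardinality of the parity
class, and `∑_{n} g(t n) = ∑_{s ∈ 𝒲_r} g(s)`. [folklore] -/
theorem parity_image_facts {t : ℕ → ℝ} {B : Finset ℕ} (ht : ∀ n ∈ B, (n : ℝ) ≤ t n ∧ t n ≤ n + 1)
    (r : ℕ) (g : ℝ → ℝ) :
    (∀ s ∈ (B.filter (fun k => k % 2 = r)).image t, ∀ s' ∈ (B.filter (fun k => k % 2 = r)).image t,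
        s ≠ s' → 1 ≤ |s - s'|) ∧
      #((B.filter (fun k => k % 2 = r)).image t) = #(B.filter (fun k => k % 2 = r)) ∧
      ∑ n ∈ B.filter (fun k => k % 2 = r), g (t n) = ∑ s ∈ (B.filter (fun k => k % 2 = r)).image t, g s := by
  have hinj : Set.InjOn t ↑(B.filter (fun k => k % 2 = r)) := by
    intro m hm n hn hmn
    by_contra h
    have := abs_sub_ge_one_of_parity ht hm hn h
    rw [hmn, sub_self, abs_zero] at this
    linarith
  refine ⟨?_, Finset.card_image_of_injOn hinj, (Finset.sum_image hinj).symm⟩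
  intro s hs s' hs' hss'
  rw [Finset.mem_image] at hs hs'
  obtain ⟨m, hm, rfl⟩ := hs
  obtain ⟨n, hn, rfl⟩ := hs'
  exact abs_sub_ge_one_of_parity ht hm hn (fun h => hss' (by rw [h]))

end Literature.NumberTheory.Sieve.Lichtman2020

namespace Literature.NumberTheory.Sieve.Lichtman2020

/-! ### The coefficient sequences `λχ`, `λχ𝟙_S` -/

/-- `λ(n)χ(n)` as a complex sequence on `ℕ`. [cite: Lichtman2020, Proposition 5.1] -/
def lamChi {q : ℕ} (χ : DirichletCharacter ℂ q) (n : ℕ) : ℂ :=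
  ((ArithmeticFunction.liouville n : ℤ) : ℂ) * χ (n : ZMod q)

/-- `λχ𝟙_S` for a decidable predicate `S`. [cite: Lichtman2020, Proposition 5.1] -/
def lamChiOn (S : ℕ → Prop) [DecidablePred S] {q : ℕ} (χ : DirichletCharacter ℂ q) (n : ℕ) : ℂ :=
  if S n then lamChi χ n else 0

/-- `‖λ(n)χ(n)‖ ≤ 1`. [folklore] -/
theorem norm_lamChi_le {q : ℕ} (χ : DirichletCharacter ℂ q) (n : ℕ) : ‖lamChi χ n‖ ≤ 1 := by
  unfold lamChi
  rw [norm_mul]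
  have h1 : ‖((ArithmeticFunction.liouville n : ℤ) : ℂ)‖ ≤ 1 := by
    rw [Complex.norm_intCast]
    rcases Nat.eq_zero_or_pos n with rfl | hn
    · simp
    · rw [ArithmeticFunction.liouville_apply hn.ne']
      rcases neg_one_pow_eq_or ℤ (ArithmeticFunction.cardFactors n) with h | h <;> simp [h]
  have h2 : ‖χ (n : ZMod q)‖ ≤ 1 := DirichletCharacter.norm_le_one χ _
  calc ‖((ArithmeticFunction.liouville n : ℤ) : ℂ)‖ * ‖χ (n : ZMod q)‖ ≤ 1 * 1 := by
        gcongr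
    _ = 1 := one_mul _

/-- `‖λχ𝟙_S‖ ≤ 1`. [folklore] -/
theorem norm_lamChiOn_le (S : ℕ → Prop) [DecidablePred S] {q : ℕ} (χ : DirichletCharacter ℂ q)
    (n : ℕ) : ‖lamChiOn S χ n‖ ≤ 1 := by
  unfold lamChiOn; split_ifs
  · exact norm_lamChi_le χ n
  · simp

/-- `λχ` is completely multiplicative. [folklore] -/
theorem lamChi_mul {q : ℕ} (χ : DirichletCharacter ℂ q) (m n : ℕ) :
    lamChi χ (m * n) = lamChi χ m * lamChi χ n := by
  unfold lamChi
  rw [ArithmeticFunction.liouville_apply_mul, Nat.cast_mul, map_mul]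
  push_cast
  ring

/-! ### Typical factorisations and one prime factor -/

/-- If `p` is a prime of `[P, Q]` and `m ≠ 0` then `mp` has a prime factor in `[P, Q]`. [folklore] -/
theorem hasPrimeFactorIn_mul_of_prime {P Q : ℝ} {m p : ℕ} (hp : p.Prime) (hm : m ≠ 0)
    (hP : P ≤ p) (hQ : (p : ℝ) ≤ Q) : HasPrimeFactorIn P Q (m * p) := by
  refine ⟨p, ?_, hP, hQ⟩
  rw [Nat.mem_primeFactors]
  exact ⟨hp, dvd_mul_left p m, mul_ne_zero hm hp.ne_zero⟩

/-- If the prime `p` is not in `[P, Q]` then `mp` has a prime factor in `[P, Q]` iff `m` has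
(`m ≠ 0`). [folklore] -/
theorem hasPrimeFactorIn_mul_prime_iff {P Q : ℝ} {m p : ℕ} (hp : p.Prime) (hm : m ≠ 0)
    (hnot : ¬ (P ≤ p ∧ (p : ℝ) ≤ Q)) : HasPrimeFactorIn P Q (m * p) ↔ HasPrimeFactorIn P Q m := by
  unfold HasPrimeFactorIn
  rw [Nat.primeFactors_mul hm hp.ne_zero, hp.primeFactors]
  constructor
  · rintro ⟨r, hr, hPr, hQr⟩
    rcases Finset.mem_union.mp hr with h | h
    · exact ⟨r, h, hPr, hQr⟩
    · rw [Finset.mem_singleton] at h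
      subst h
      exact absurd ⟨hPr, hQr⟩ hnot
  · rintro ⟨r, hr, hPr, hQr⟩
    exact ⟨r, Finset.mem_union.mpr (Or.inl hr), hPr, hQr⟩

/-- **The factorisation hypothesis of Lemma 12 for `a = λχ𝟙_S`**, `S = {HasPF[P,Q] ∧ HasPF[P',Q']}`
with `[P, Q]` and `[P', Q']` disjoint: for a prime `p ∈ [P, Q]` not dividing `m`,
`a(mp) = b(m) c(p)` with `b = λχ𝟙_{HasPF[P',Q']}`, `c = λχ`. [cite: Lichtman2020, §5.1] -/
theorem lamChiOn_factor {P Q P' Q' : ℝ} (hdisj : ∀ p : ℕ, P ≤ p → (p : ℝ) ≤ Q → ¬ (P' ≤ p ∧ (p : ℝ) ≤ Q'))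
    {q : ℕ} (χ : DirichletCharacter ℂ q) (m p : ℕ) (hp : p.Prime) (hP : P ≤ p) (hQ : (p : ℝ) ≤ Q)
    (hpm : ¬ p ∣ m) :
    lamChiOn (fun n => HasPrimeFactorIn P Q n ∧ HasPrimeFactorIn P' Q' n) χ (m * p) =
      lamChiOn (HasPrimeFactorIn P' Q') χ m * lamChi χ p := by
  have hm : m ≠ 0 := by rintro rfl; exact hpm (dvd_zero p)
  unfold lamChiOn
  have h1 : HasPrimeFactorIn P Q (m * p) := hasPrimeFactorIn_mul_of_prime hp hm hP hQ
  have h2 : HasPrimeFactorIn P' Q' (m * p) ↔ HasPrimeFactorIn P' Q' m :=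
    hasPrimeFactorIn_mul_prime_iff hp hm (hdisj p hP hQ)
  by_cases hm' : HasPrimeFactorIn P' Q' m
  · rw [if_pos ⟨h1, h2.mpr hm'⟩, if_pos hm', lamChi_mul]
  · rw [if_neg (fun h => hm' (h2.mp h.2)), if_neg hm', zero_mul]

/-- The same with the roles of the two intervals exchanged (`S` written in the same order). [cite: Lichtman2020, §5.1] -/
theorem lamChiOn_factor' {P Q P' Q' : ℝ} (hdisj : ∀ p : ℕ, P' ≤ p → (p : ℝ) ≤ Q' → ¬ (P ≤ p ∧ (p : ℝ) ≤ Q))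
    {q : ℕ} (χ : DirichletCharacter ℂ q) (m p : ℕ) (hp : p.Prime) (hP : P' ≤ p) (hQ : (p : ℝ) ≤ Q')
    (hpm : ¬ p ∣ m) :
    lamChiOn (fun n => HasPrimeFactorIn P Q n ∧ HasPrimeFactorIn P' Q' n) χ (m * p) =
      lamChiOn (HasPrimeFactorIn P Q) χ m * lamChi χ p := by
  have hm : m ≠ 0 := by rintro rfl; exact hpm (dvd_zero p)
  unfold lamChiOn
  have h1 : HasPrimeFactorIn P' Q' (m * p) := hasPrimeFactorIn_mul_of_prime hp hm hP hQ
  have h2 : HasPrimeFactorIn P Q (m * p) ↔ HasPrimeFactorIn P Q m :=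
    hasPrimeFactorIn_mul_prime_iff hp hm (hdisj p hP hQ)
  by_cases hm' : HasPrimeFactorIn P Q m
  · rw [if_pos ⟨h2.mpr hm', h1⟩, if_pos hm', lamChi_mul]
  · rw [if_neg (fun h => hm' (h2.mp h.1)), if_neg hm', zero_mul]

/-- **The coprime sum of Lemma 12 vanishes**: an `n` with no prime factor among the primes of
`[⌈P⌉, ⌊Q⌋]` has `𝟙_S(n) = 0` when `S` requires a prime factor in `[P, Q]`. [cite: Lichtman2020, §5.1] -/
theorem lamChiOn_eq_zero_of_coprime {P Q : ℝ} {S : ℕ → Prop} [DecidablePred S]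
    (hS : ∀ n, S n → HasPrimeFactorIn P Q n) {q : ℕ} (χ : DirichletCharacter ℂ q) {n : ℕ}
    (hn : ∀ p ∈ (Icc ⌈P⌉₊ ⌊Q⌋₊).filter Nat.Prime, ¬ p ∣ n) : lamChiOn S χ n = 0 := by
  unfold lamChiOn
  rw [if_neg]
  intro hSn
  obtain ⟨p, hp, hP, hQ⟩ := hS n hSn
  have hpp := Nat.prime_of_mem_primeFactors hp
  refine hn p ?_ (Nat.dvd_of_mem_primeFactors hp)
  simp only [Finset.mem_filter, Finset.mem_Icc]
  exact ⟨⟨Nat.ceil_le.mpr hP, Nat.le_floor hQ⟩, hpp⟩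

/-! ### Lemma 12 applied to `G(1+it) = ∑_{Y ≤ n ≤ 2Y, n ∈ S} λ(n)χ(n) n^{-1-it}` -/

/-- The hypothesis-shape of Matomäki–Radziwiłł's Lemma 12 with constant `C₁₂`
(`MatomakiRadziwill2016_lemma12_decomp = ∃ C₁₂, Lemma12With C₁₂`, the correctly parenthesised rendering
of `MatomakiRadziwillLemma12.lean`, proved there). [cite: MatomakiRadziwillAnnals2016, Lemma 12] -/
def Lemma12With (C : ℝ) : Prop :=
  ∀ (X T P Q H : ℝ) (a b c : ℕ → ℂ) (𝒯 : Set ℝ), 1 ≤ X → 1 ≤ T → 1 ≤ P → P ≤ Q → 1 ≤ H →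
    (∀ n, ‖a n‖ ≤ 1) → (∀ m, ‖b m‖ ≤ 1) → (∀ p, ‖c p‖ ≤ 1) →
    (∀ m p : ℕ, p.Prime → P ≤ p → (p : ℝ) ≤ Q → ¬ p ∣ m → a (m * p) = b m * c p) →
    MeasurableSet 𝒯 → 𝒯 ⊆ Set.Icc (-T) T →
    ∫ t in 𝒯, ‖∑ n ∈ Icc ⌈X⌉₊ ⌊2 * X⌋₊, a n * (n : ℂ) ^ (-(1 + (t : ℂ) * I))‖ ^ 2 ≤
      C * ((H * Real.log (Q / P)) *
              (∑ j ∈ Icc ⌊H * Real.log P⌋₊ ⌊H * Real.log Q⌋₊,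
                ∫ t in 𝒯, ‖blockPrimePoly c P Q H j t * blockCofactorPoly b X P Q H j t‖ ^ 2)
            + (T + X) / X * (1 / H + 1 / P
                + ∑ n ∈ (Icc ⌈X⌉₊ ⌊2 * X⌋₊).filter
                    (fun n : ℕ => ∀ p ∈ (Icc ⌈P⌉₊ ⌊Q⌋₊).filter Nat.Prime, ¬ p ∣ n),
                    ‖a n‖ ^ 2 / n))

/-- `MatomakiRadziwill2016_lemma12_decomp` is `∃ C, Lemma12With C`. [cite: MatomakiRadziwillAnnals2016, Lemma 12] -/
theorem lemma12With_of_decomp (h : MatomakiRadziwill2016_lemma12_decomp) : ∃ C, Lemma12With C := h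

/-- The sum `G` over the filtered range equals the sum of `λχ𝟙_S` over the full range. [folklore] -/
theorem sum_filter_eq_sum_lamChiOn (S : ℕ → Prop) [DecidablePred S] {q : ℕ}
    (χ : DirichletCharacter ℂ q) (R : Finset ℕ) (t : ℝ) :
    ∑ n ∈ R.filter S, ((ArithmeticFunction.liouville n : ℤ) : ℂ) * χ (n : ZMod q) *
        (n : ℂ) ^ (-(1 + (t : ℂ) * I)) =
      ∑ n ∈ R, lamChiOn S χ n * (n : ℂ) ^ (-(1 + (t : ℂ) * I)) := by
  rw [Finset.sum_filter]
  refine Finset.sum_congr rfl fun n _ => ?_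
  unfold lamChiOn lamChi
  split_ifs <;> simp

/-- **Lemma 12 for `G` along the first interval**: with `S = HasPF[P₁,Q₁] ∧ HasPF[P₂,Q₂]`,
`[P₁,Q₁] ∩ [P₂,Q₂] = ∅`, `b = λχ𝟙_{HasPF[P₂,Q₂]}`, `c = λχ`, the coprime sum vanishes and
`∫_𝒯 |G|² ≤ C₁₂ (V log(Q₁/P₁) ∑_v ∫_𝒯 |Q_v R_v|² + (T+Y)/Y (1/V + 1/P₁))`.
[cite: Lichtman2020, §5.1, display before (5.9)] -/
theorem ramare_first {C₁₂ : ℝ} (h12 : Lemma12With C₁₂) {P₁ Q₁ P₂ Q₂ Y T V : ℝ}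
    (hY : 1 ≤ Y) (hT : 1 ≤ T) (hP₁ : 1 ≤ P₁) (hPQ₁ : P₁ ≤ Q₁) (hV : 1 ≤ V)
    (hdisj : ∀ p : ℕ, P₁ ≤ p → (p : ℝ) ≤ Q₁ → ¬ (P₂ ≤ p ∧ (p : ℝ) ≤ Q₂))
    {q : ℕ} (χ : DirichletCharacter ℂ q) {𝒯 : Set ℝ} (h𝒯 : MeasurableSet 𝒯)
    (h𝒯T : 𝒯 ⊆ Set.Icc (-T) T) :
    ∫ t in 𝒯, ‖∑ n ∈ (Icc ⌈Y⌉₊ ⌊2 * Y⌋₊).filter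
        (fun n => HasPrimeFactorIn P₁ Q₁ n ∧ HasPrimeFactorIn P₂ Q₂ n),
        ((ArithmeticFunction.liouville n : ℤ) : ℂ) * χ (n : ZMod q) * (n : ℂ) ^ (-(1 + (t : ℂ) * I))‖ ^ 2 ≤
      C₁₂ * ((V * Real.log (Q₁ / P₁)) *
          (∑ v ∈ Icc ⌊V * Real.log P₁⌋₊ ⌊V * Real.log Q₁⌋₊,
            ∫ t in 𝒯, ‖blockPrimePoly (lamChi χ) P₁ Q₁ V v t *
              blockCofactorPoly (lamChiOn (HasPrimeFactorIn P₂ Q₂) χ) Y P₁ Q₁ V v t‖ ^ 2)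
        + (T + Y) / Y * (1 / V + 1 / P₁)) := by
  have key := h12 Y T P₁ Q₁ V
    (lamChiOn (fun n => HasPrimeFactorIn P₁ Q₁ n ∧ HasPrimeFactorIn P₂ Q₂ n) χ)
    (lamChiOn (HasPrimeFactorIn P₂ Q₂) χ) (lamChi χ) 𝒯 hY hT hP₁ hPQ₁ hV
    (norm_lamChiOn_le _ χ) (norm_lamChiOn_le _ χ) (norm_lamChi_le χ)
    (fun m p hp hP hQ hpm => lamChiOn_factor hdisj χ m p hp hP hQ hpm) h𝒯 h𝒯T
  simp_rw [sum_filter_eq_sum_lamChiOn]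
  have hz : ∑ n ∈ (Icc ⌈Y⌉₊ ⌊2 * Y⌋₊).filter
      (fun n : ℕ => ∀ p ∈ (Icc ⌈P₁⌉₊ ⌊Q₁⌋₊).filter Nat.Prime, ¬ p ∣ n),
      ‖lamChiOn (fun n => HasPrimeFactorIn P₁ Q₁ n ∧ HasPrimeFactorIn P₂ Q₂ n) χ n‖ ^ 2 / n = 0 := by
    refine Finset.sum_eq_zero fun n hn => ?_
    rw [Finset.mem_filter] at hn
    rw [lamChiOn_eq_zero_of_coprime (fun n h => h.1) χ hn.2, norm_zero]
    simp
  rw [hz, add_zero] at key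
  exact key

/-- **Lemma 12 for `G` along the second interval** (`b = λχ𝟙_{HasPF[P₁,Q₁]}`).
[cite: Lichtman2020, §5.1, display before (5.9)] -/
theorem ramare_second {C₁₂ : ℝ} (h12 : Lemma12With C₁₂) {P₁ Q₁ P₂ Q₂ Y T V : ℝ}
    (hY : 1 ≤ Y) (hT : 1 ≤ T) (hP₂ : 1 ≤ P₂) (hPQ₂ : P₂ ≤ Q₂) (hV : 1 ≤ V)
    (hdisj : ∀ p : ℕ, P₂ ≤ p → (p : ℝ) ≤ Q₂ → ¬ (P₁ ≤ p ∧ (p : ℝ) ≤ Q₁))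
    {q : ℕ} (χ : DirichletCharacter ℂ q) {𝒯 : Set ℝ} (h𝒯 : MeasurableSet 𝒯)
    (h𝒯T : 𝒯 ⊆ Set.Icc (-T) T) :
    ∫ t in 𝒯, ‖∑ n ∈ (Icc ⌈Y⌉₊ ⌊2 * Y⌋₊).filter
        (fun n => HasPrimeFactorIn P₁ Q₁ n ∧ HasPrimeFactorIn P₂ Q₂ n),
        ((ArithmeticFunction.liouville n : ℤ) : ℂ) * χ (n : ZMod q) * (n : ℂ) ^ (-(1 + (t : ℂ) * I))‖ ^ 2 ≤
      C₁₂ * ((V * Real.log (Q₂ / P₂)) *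
          (∑ v ∈ Icc ⌊V * Real.log P₂⌋₊ ⌊V * Real.log Q₂⌋₊,
            ∫ t in 𝒯, ‖blockPrimePoly (lamChi χ) P₂ Q₂ V v t *
              blockCofactorPoly (lamChiOn (HasPrimeFactorIn P₁ Q₁) χ) Y P₂ Q₂ V v t‖ ^ 2)
        + (T + Y) / Y * (1 / V + 1 / P₂)) := by
  have key := h12 Y T P₂ Q₂ V
    (lamChiOn (fun n => HasPrimeFactorIn P₁ Q₁ n ∧ HasPrimeFactorIn P₂ Q₂ n) χ)
    (lamChiOn (HasPrimeFactorIn P₁ Q₁) χ) (lamChi χ) 𝒯 hY hT hP₂ hPQ₂ hV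
    (norm_lamChiOn_le _ χ) (norm_lamChiOn_le _ χ) (norm_lamChi_le χ)
    (fun m p hp hP hQ hpm => lamChiOn_factor' hdisj χ m p hp hP hQ hpm) h𝒯 h𝒯T
  simp_rw [sum_filter_eq_sum_lamChiOn]
  have hz : ∑ n ∈ (Icc ⌈Y⌉₊ ⌊2 * Y⌋₊).filter
      (fun n : ℕ => ∀ p ∈ (Icc ⌈P₂⌉₊ ⌊Q₂⌋₊).filter Nat.Prime, ¬ p ∣ n),
      ‖lamChiOn (fun n => HasPrimeFactorIn P₁ Q₁ n ∧ HasPrimeFactorIn P₂ Q₂ n) χ n‖ ^ 2 / n = 0 := by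
    refine Finset.sum_eq_zero fun n hn => ?_
    rw [Finset.mem_filter] at hn
    rw [lamChiOn_eq_zero_of_coprime (fun n h => h.2) χ hn.2, norm_zero]
    simp
  rw [hz, add_zero] at key
  exact key

end Literature.NumberTheory.Sieve.Lichtman2020

namespace Literature.NumberTheory.Sieve.Lichtman2020

/-! ### The hypothesis-shape of Lemma 9 -/

/-- The hypothesis-shape of Matomäki–Radziwiłł's Lemma 9 with constant `C₉`. [cite: MatomakiRadziwillAnnals2016, Lemma 9] -/
def Lemma9With (C₉ : ℝ) : Prop :=
  ∀ (N : ℕ) (a : ℕ → ℂ) (T : ℝ) (𝒯 : Finset ℝ), 1 ≤ N → 1 ≤ T →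
    (∀ t ∈ 𝒯, |t| ≤ T) → (∀ t ∈ 𝒯, ∀ t' ∈ 𝒯, t ≠ t' → 1 ≤ |t - t'|) →
    ∑ t ∈ 𝒯, ‖∑ n ∈ Finset.Icc 1 N, a n * (n : ℂ) ^ (-((t : ℂ) * I))‖ ^ 2 ≤
      C₉ * (N + 𝒯.card * Real.sqrt T) * Real.log (2 * T) * ∑ n ∈ Finset.Icc 1 N, ‖a n‖ ^ 2

/-- `MatomakiRadziwill2016_lemma9 → ∃ C, Lemma9With C`. [cite: MatomakiRadziwillAnnals2016, Lemma 9] -/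
theorem lemma9With_of (h : Literature.NumberTheory.LFunctions.MatomakiRadziwill2016_lemma9) :
    ∃ C, Lemma9With C := h

end Literature.NumberTheory.Sieve.Lichtman2020

namespace Literature.NumberTheory.Sieve

namespace Lichtman2020

/-! ### Lemma 4.5 on the blocks `Q_{v,2}` -/

/-- On primes `λχ = -χ`. [folklore] -/
theorem lamChi_prime {q : ℕ} (χ : DirichletCharacter ℂ q) {p : ℕ} (hp : p.Prime) :
    lamChi χ p = -χ (p : ZMod q) := by
  unfold lamChi
  rw [ArithmeticFunction.liouville_apply hp.ne_zero, ArithmeticFunction.cardFactors_apply_prime hp]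
  push_cast
  ring

/-- `|Q_{v}(1+it)|` for `c = λχ` is the norm of the character prime polynomial over the block. [folklore] -/
theorem norm_blockPrimePoly_lamChi {q : ℕ} (χ : DirichletCharacter ℂ q) (P Q H : ℝ) (v : ℕ) (t : ℝ) :
    ‖blockPrimePoly (lamChi χ) P Q H v t‖ =
      ‖∑ p ∈ primeBlock P Q H v, χ (p : ZMod q) * (p : ℂ) ^ (-(1 + (t : ℂ) * I))‖ := by
  rw [blockPrimePoly_eq_sum_primeBlock, ← norm_neg, ← Finset.sum_neg_distrib]
  congr 1
  refine Finset.sum_congr rfl fun p hp => ?_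
  rw [lamChi_prime χ (mem_primeBlock hp).1]
  ring

/-- **Lemma 4.5 applied to a block of the second interval**: if the character prime polynomials over
intervals `[P, Q] ⊆ [exp((log X')^θ), X']` are bounded by `C₄₅ (log X'/(1+|t|) + (log X')^{-K})` for
`|t| ≤ X'`, then so is `|Q_{v,2}(1+it)|` (with `C₄₅⁺`), the block being the set of primes of a closed
subinterval of `[P₂, Q₂]` (`primeBlock_eq_interval`). [cite: Lichtman2020, Lemma 4.5 and (5.9)] -/
theorem norm_blockPrimePoly_le_of_L45 {C₄₅ A K θ X' : ℝ}
    (h45 : ∀ q : ℕ, 1 ≤ q → (q : ℝ) ≤ Real.log X' ^ A → ∀ χ : DirichletCharacter ℂ q,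
      ∀ P Q : ℝ, Real.exp (Real.log X' ^ θ) ≤ P → P ≤ Q → Q ≤ X' → ∀ t : ℝ, |t| ≤ X' →
        ‖∑ p ∈ (Icc ⌈P⌉₊ ⌊Q⌋₊).filter Nat.Prime, χ (p : ZMod q) * (p : ℂ) ^ (-(1 + (t : ℂ) * I))‖
          ≤ C₄₅ * (Real.log X' / (1 + |t|) + Real.log X' ^ (-K)))
    (hX' : 1 ≤ X') {q : ℕ} (hq : 1 ≤ q) (hqA : (q : ℝ) ≤ Real.log X' ^ A) (χ : DirichletCharacter ℂ q)
    {P₂ Q₂ H : ℝ} (hP₂ : Real.exp (Real.log X' ^ θ) ≤ P₂) (hQ₂ : Q₂ ≤ X') (v : ℕ) {t : ℝ}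
    (ht : |t| ≤ X') :
    ‖blockPrimePoly (lamChi χ) P₂ Q₂ H v t‖ ≤
      max C₄₅ 0 * (Real.log X' / (1 + |t|) + Real.log X' ^ (-K)) := by
  rw [norm_blockPrimePoly_lamChi, primeBlock_eq_interval]
  set P' := max P₂ (Real.exp (v / H)) with hP'
  set Q' := min Q₂ ((⌈Real.exp ((v + 1) / H)⌉₊ : ℝ) - 1) with hQ'
  have hlog : 0 ≤ Real.log X' := Real.log_nonneg hX'
  have hbr : 0 ≤ Real.log X' / (1 + |t|) + Real.log X' ^ (-K) := by
    have : 0 ≤ Real.log X' ^ (-K) := Real.rpow_nonneg hlog _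
    positivity
  rcases le_or_gt P' Q' with hPQ | hPQ
  · have h := h45 q hq hqA χ P' Q' (hP₂.trans (le_max_left _ _)) hPQ ((min_le_left _ _).trans hQ₂) t ht
    refine h.trans ?_
    exact mul_le_mul_of_nonneg_right (le_max_left _ _) hbr
  · have hempty : Icc ⌈P'⌉₊ ⌊Q'⌋₊ = ∅ := by
      rw [Finset.Icc_eq_empty_iff, not_le]
      have hP'0 : 0 < P' := lt_of_lt_of_le (Real.exp_pos _) (le_max_right _ _)
      rcases le_or_gt 0 Q' with hQ0 | hQ0
      · have h1 : (⌊Q'⌋₊ : ℝ) ≤ Q' := Nat.floor_le hQ0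
        have h2 : P' ≤ ⌈P'⌉₊ := Nat.le_ceil _
        exact_mod_cast (show (⌊Q'⌋₊ : ℝ) < ⌈P'⌉₊ by linarith)
      · rw [Nat.floor_of_nonpos hQ0.le]
        exact Nat.ceil_pos.mpr hP'0
    rw [hempty, Finset.filter_empty, Finset.sum_empty, norm_zero]
    positivity

/-! ### Growth lemmas along `X : ℕ` -/

/-- **Sub-linear terms**: for `a₁, a₂ < 1` and `ε > 0`, eventually
`k + (log X)^{a₁} + (log X)^{a₂} + b log log X ≤ ε log X`. [folklore] -/
theorem eventually_small_terms (k b : ℝ) {a₁ a₂ ε : ℝ} (ha₁ : a₁ < 1) (ha₂ : a₂ < 1) (hε : 0 < ε) :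
    ∀ᶠ X : ℕ in atTop,
      k + Real.log X ^ a₁ + Real.log X ^ a₂ + b * Real.log (Real.log X) ≤ ε * Real.log X := by
  have hε4 : 0 < ε / 4 := by positivity
  have hb : 0 < ε / (4 * (|b| + 1)) := by positivity
  filter_upwards [eventually_rpow_log_le_mul_log ha₁ hε4, eventually_rpow_log_le_mul_log ha₂ hε4,
    eventually_loglog_le_mul_log hb, tendsto_log_natCast.eventually_ge_atTop (4 * |k| / ε),
    (Real.tendsto_log_atTop.comp tendsto_log_natCast).eventually_ge_atTop 0] with X h1 h2 h3 h4 h5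
  have hL0 : 0 ≤ Real.log X := le_trans (by positivity) h4
  have hk : k ≤ ε / 4 * Real.log X := by
    have : |k| ≤ ε / 4 * Real.log X := by
      rw [div_le_iff₀ hε] at h4; linarith
    linarith [le_abs_self k]
  have hbl : b * Real.log (Real.log X) ≤ ε / 4 * Real.log X := by
    have h3' : (|b| + 1) * Real.log (Real.log X) ≤ ε / 4 * Real.log X := by
      have := mul_le_mul_of_nonneg_left h3 (by positivity : 0 ≤ |b| + 1)
      refine this.trans (le_of_eq ?_)
      field_simp
    have h5' : 0 ≤ Real.log (Real.log X) := h5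
    have : b * Real.log (Real.log X) ≤ (|b| + 1) * Real.log (Real.log X) := by
      apply mul_le_mul_of_nonneg_right _ h5'
      linarith [le_abs_self b]
    linarith
  linarith

end Lichtman2020

end Literature.NumberTheory.Sieve

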